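import Summits.HubbardSuperconductivity.HubbardSuperconductivity.Theorems.AnisotropyChordTransferFibre3ManifoldA48
import Summits.HubbardSuperconductivity.HubbardSuperconductivity.Theorems.AnisotropyChordTransferFibre3L2BlockCover

/-!
# Route `AnisotropyChord` / H0 rotor rung, LEVEL 2 on the t-BLOCK `[48,64)`: the REGION of the ground manifold and the ν-location for `L ≥ 48`

Companion of `…N1RowTCover` / `…L2BlockCover` at the block floor `L₀ = 48` (family A at `L ≥ 48`: `…ManifoldA48`):
* `AbarQ48 ν = (2304/2303)(1 − q₁ν − q₂ν²)`, `q₁ = 1303/50 = 26.06 ≤ 2π·3.8712 + 4π²·0.0442`, `q₂ = 49979/10000 ≤ 4π²·0.1266`;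
* ★ `a_le_AbarQ48` (`L ≥ 48`), `region_sides48` (`0 ≤ a`, `0 < ν < .0384`), ★ `nu_loc48`: every ground profile of `(L, Δ)` with
  `48 ≤ L ≤ 2^200`, `0 < Δ ≤ 49/50` has `ν ∈ [2.39·10⁻⁴, 0.0384]`.
Prover seat `hubbard-h0-rotor-p2` g8; helper for piece A = stmt-HubbardSuperconductivity-23918 of rung 19089 (`--supports`, helper class).
Nothing here proves superconductivity in the Hubbard model; cover lemmas of ONE conditional reduction on the t-blocks.  Tree imports only; no sorry.
-/

set_option linter.dupNamespace false
set_option autoImplicit false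

open Literature.Analysis.ValidatedNumerics

namespace Summit.HubbardSuperconductivity.HubbardSuperconductivity.Theorems.AnisotropyChord.Transfer.Fibre3.L2.N1

variable (L : ℕ) [NeZero L]

/-- the rational outer edge of the manifold band at `L ≥ 48`: `AbarQ48(ν) = (2304/2303)(1 − q₁ν − q₂ν²)`. -/
def AbarQ48 (ν : ℚ) : ℚ := 2304 / 2303 * (1 - 1303 / 50 * ν - 49979 / 10000 * ν ^ 2)

/-- the same function over `ℝ`. -/
theorem AbarQ48_cast (ν : ℚ) : ((AbarQ48 ν : ℚ) : ℝ)
    = 2304 / 2303 * (1 - 1303 / 50 * (ν : ℝ) - 49979 / 10000 * (ν : ℝ) ^ 2) := by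
  unfold AbarQ48; push_cast; ring

/-- ★ the `L`-uniform outer edge at `L ≥ 48`: `a ≤ (2304/2303)(1 − q₁ν − q₂ν²)` for every ground profile, `0 ≤ Δ < 1`. -/
theorem a_le_AbarQ48 (hL : 48 ≤ L) {Δ lam2 : ℝ} (hΔ0 : 0 ≤ Δ) (hΔ1 : Δ < 1) {f : Tor L → ℝ}
    (hf : IsGroundTwoMagnon L Δ lam2 f) :
    Δ * f (K1 L) ≤ 2304 / 2303 * (1 - 1303 / 50 * (lam2 / (2 * Real.pi / L) ^ 2)
      - 49979 / 10000 * (lam2 / (2 * Real.pi / L) ^ 2) ^ 2) := by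
  obtain ⟨ha0, _, _, hband⟩ := ManifoldA.manifold_band48 L hL hΔ0 hΔ1 hf
  obtain ⟨_, _, _, _, _, _, d7⟩ := ManifoldA.manifold_dictionary L (by omega) hΔ0 hΔ1 hf
  set a := Δ * f (K1 L) with ha
  set ν := lam2 / (2 * Real.pi / L) ^ 2 with hν
  set V : ℝ := (L : ℝ) ^ 2 with hV
  have hLR : (48 : ℝ) ≤ L := by exact_mod_cast hL
  have hV1 : (2304 : ℝ) ≤ V := by rw [hV]; nlinarith only [hLR]
  have hπlo : (3.141592 : ℝ) < Real.pi := Real.pi_gt_d6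
  have hπ := Real.pi_pos
  have hlam : 0 < lam2 := lam2_pos L (by omega) hΔ1 hf.1
  have hLpos : (0 : ℝ) < L := by linarith
  have hν0 : 0 < ν := by rw [hν]; positivity
  have hlog : (3.8712 : ℝ) ≤ Real.log L :=
    ManifoldA.log_48_ge.trans (Real.log_le_log (by norm_num) hLR)
  set g : ℝ := Real.log L / (2 * Real.pi) + 0.0442 + 0.1266 * ν with hg
  have hη : etaEff L lam2 = Real.pi ^ 2 * ν := by rw [d7]
  have hg0 : 3.8712 / (2 * Real.pi) + 0.0442 + 0.1266 * ν ≤ g := by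
    have := div_le_div_of_nonneg_right hlog (by positivity : (0 : ℝ) ≤ 2 * Real.pi)
    rw [hg]; linarith only [this]
  have hkey : 4 * (Real.pi ^ 2 * ν) * g ≥ 1303 / 50 * ν + 49979 / 10000 * ν ^ 2 := by
    have h1 : 4 * (Real.pi ^ 2 * ν) * g ≥ 4 * (Real.pi ^ 2 * ν) * (3.8712 / (2 * Real.pi) + 0.0442 + 0.1266 * ν) :=
      mul_le_mul_of_nonneg_left hg0 (by positivity)
    have h2 : 4 * (Real.pi ^ 2 * ν) * (3.8712 / (2 * Real.pi) + 0.0442 + 0.1266 * ν)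
        = 2 * Real.pi * 3.8712 * ν + 4 * Real.pi ^ 2 * 0.0442 * ν + 4 * Real.pi ^ 2 * 0.1266 * ν ^ 2 := by
      field_simp; ring
    rw [h2] at h1
    have hπ2 : (3.141592 : ℝ) ^ 2 ≤ Real.pi ^ 2 := by nlinarith only [hπlo]
    have hA : (1303 / 50 : ℝ) ≤ 2 * Real.pi * 3.8712 + 4 * Real.pi ^ 2 * 0.0442 := by nlinarith only [hπlo, hπ2]
    have hB : (49979 / 10000 : ℝ) ≤ 4 * Real.pi ^ 2 * 0.1266 := by nlinarith only [hπ2]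
    have hA' := mul_le_mul_of_nonneg_right hA hν0.le
    have hB' := mul_le_mul_of_nonneg_right hB (sq_nonneg ν)
    linarith only [h1, hA', hB']
  set R : ℝ := 1 - 1303 / 50 * ν - 49979 / 10000 * ν ^ 2 with hR
  have hb : a * (V - 1) ≤ V * R := by
    rw [hη] at hband
    have : V * (1 - 4 * (Real.pi ^ 2 * ν) * g) ≤ V * R := by
      apply mul_le_mul_of_nonneg_left _ (by positivity); rw [hR]; linarith only [hkey]
    exact hband.trans this
  have hV0 : 0 < V - 1 := by linarith only [hV1]
  by_cases hR0 : 0 ≤ R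
  · -- `a ≤ V/(V−1)·R ≤ (2304/2303)·R`
    have hRV : 0 ≤ R * (V - 2304) := mul_nonneg hR0 (by linarith only [hV1])
    have h1 : a * (V - 1) ≤ (2304 / 2303 * R) * (V - 1) := by
      have : V * R ≤ 2304 / 2303 * R * (V - 1) := by linarith only [hRV]
      linarith only [this, hb]
    exact le_of_mul_le_mul_right h1 hV0
  · push Not at hR0
    have hneg : V * R < 0 := mul_neg_of_pos_of_neg (by linarith only [hV1]) hR0
    have h3 : a * (V - 1) < 0 := lt_of_le_of_lt hb hneg
    have h4 : 0 ≤ a * (V - 1) := mul_nonneg ha0 hV0.le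
    linarith only [h3, h4]

/-- the three other sides of the region at `L ≥ 48`: `0 ≤ a`, `0 < ν`, `ν < 0.0384`. -/
theorem region_sides48 (hL : 48 ≤ L) {Δ lam2 : ℝ} (hΔ0 : 0 ≤ Δ) (hΔ1 : Δ < 1) {f : Tor L → ℝ}
    (hf : IsGroundTwoMagnon L Δ lam2 f) :
    0 ≤ Δ * f (K1 L) ∧ 0 < lam2 / (2 * Real.pi / L) ^ 2 ∧ lam2 / (2 * Real.pi / L) ^ 2 < 0.0384 := by
  have hLpos : (0 : ℝ) < L := by exact_mod_cast (show 0 < L by omega)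
  have ht : 0 < (2 * Real.pi / (L : ℝ)) ^ 2 := by positivity
  refine ⟨(ManifoldA.manifold_band48 L hL hΔ0 hΔ1 hf).1, div_pos (lam2_pos L (by omega) hΔ1 hf.1) ht, ?_⟩
  rw [div_lt_iff₀ ht]
  exact ManifoldA.nu_ceiling48 L hL hΔ0 hf

end Summit.HubbardSuperconductivity.HubbardSuperconductivity.Theorems.AnisotropyChord.Transfer.Fibre3.L2.N1

namespace Summit.HubbardSuperconductivity.HubbardSuperconductivity.Theorems.AnisotropyChord.Transfer.Fibre3.L2

/-- ★ the located hypothesis of the block theorems on `48 ≤ L ≤ 2^200`, `0 < Δ ≤ 49/50`: every ground profile has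
`ν ∈ [2.39·10⁻⁴, 0.0384]`. [folklore] -/
theorem nu_loc48 (L : ℕ) [NeZero L] (hL : 48 ≤ L) (hLmax : L ≤ 2 ^ 200) {Δ : ℝ} (hΔ0 : 0 < Δ) (hΔ98 : Δ ≤ (49 : ℝ) / 50) :
    ∀ lam2 : ℝ, ∀ f : Tor L → ℝ, IsGroundTwoMagnon L Δ lam2 f →
      (239 : ℝ) / 1000000 ≤ lam2 / (2 * Real.pi / L) ^ 2 ∧ lam2 / (2 * Real.pi / L) ^ 2 ≤ (38400 : ℝ) / 1000000 := by
  intro lam2 f hf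
  have hΔ1 : Δ < 1 := lt_of_le_of_lt hΔ98 (by norm_num)
  refine ⟨nu_ge_239_of_le5 L (by omega) hLmax hΔ0.le hΔ98 hf, ?_⟩
  have h := (L2.N1.region_sides48 L hL hΔ0.le hΔ1 hf).2.2
  norm_num at h ⊢; linarith

end Summit.HubbardSuperconductivity.HubbardSuperconductivity.Theorems.AnisotropyChord.Transfer.Fibre3.L2
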